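import Summits.AnomalousDissipation.AnomalousDissipation.Theorems.SolenoidalFractalHomogenisationLagrangianStepZ7GlueEulerThetaDefs
import HarnessLib

/-!
# K1L_D (stmt-AnomalousDissipation-27980): the EulerPiece clause and the Vmod text WITH THE CASCADE BINDER (R-L24-1) — `SlowVectorClauseEulerPieceTK`,
# `Vmod_E_textHTXK X e` (tenure RULING D28-22 (1): ACCEPTED VERBATIM, BUNDLED INTO the v29 registry plan; typist prover lead-k1l-onelevel-p1 g7)
(Summits-side definitions file of route `SolenoidalFractalHomogenisation`; review lane; TWIN texts, history kept — `…PieceT` / `Vmod_E_textHTX` untouched.)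

WHY (memo L24 §4, `Cruxes/…/Lines/onelevel-L24-longrow-architecture.md` a15aee1d26d5, test T4).  The long rows of the (ℓ3-A) distorted blocks consume the
constant-frame inputs at SYMBOL level; the symbol freezing is honest iff `ϑ := θ·(nC/n)·(M/ν)` is small, which neither the typed binder `nC ≤ ϱ₁ n` nor the
piece binders of `SlowVectorClauseEulerPieceT` (`⌈K/ν⌉ ≤ N(m+1)`, `N m ≤ ϱ₁ N(m+1)`) provide; what closes it is the CASCADE INEQUALITY
`K·(N_{m+1}/N_m)^{1/4} ≤ (N_{m+1}/N_m)·cellVisc(m+1)` (⇒ `ν_{m+1} ≥ K·(N_m/N_{m+1})^{3/4}`), which the §9z consumer already carries in its carrier template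
(`…Z7GlueEulerX` l.51/l.55 with `E.K`, plus `K ≤ E.K` l.144) and therefore discharges for free.
* `SlowVectorClauseEulerPieceTK` := `SlowVectorClauseEulerPieceT` BYTES with ONE per-level binder inserted after `(⌈K / E.cellVisc (m + 1)⌉₊ : ℝ) ≤ E.N (m + 1) →`:
  `K * ((E.N (m + 1) : ℝ) / E.N m) ^ (1 / 4 : ℝ) ≤ ((E.N (m + 1) : ℝ) / E.N m) * E.cellVisc (m + 1) →` (l.55 bytes with `E.K ↦ K`);
* `Vmod_E_textHTXK X e` := `Vmod_E_textHTX X e` BYTES concluding `…PieceTK`;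
* `slowVectorClauseEulerPieceTK_of_pieceT`, **`vmod_E_textHTXK_of_HTX : Vmod_E_textHTX X e → Vmod_E_textHTXK X e`** (the superseded-by-WEAKER certificate of
  the v29 move `stub_Vmod_EHTthg ↦ stub_Vmod_EHTthgw : Vmod_E_textHTXK Xθgw (fun σ => min (σ/2) (1/2))`), `vmod_E_textHTXK_anti` (antitone in `X`).
Consumer twin: `…Z7GlueEulerXK` (`cellInputs_BIL_ofEulerXK`, this seat).  Definitions + one-line bridges only; NOT a proof of anything; K1L_D open; AD NOT proved; rung F-D1.A0.
-/

set_option linter.dupNamespace false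

noncomputable section

namespace Summit.AnomalousDissipation.AnomalousDissipation.Theorems.SolenoidalFractalHomogenisation.LagrangianStep.Z7Glue

open Literature.Analysis Literature.Analysis.FluidPDE Literature.Analysis.FunctionSpaces
open MeasureTheory Set
open scoped InnerProductSpace
open Literature.Analysis.FluidPDE.LatticeShear (LagrangianLatticeCarrier LatticeWord)
open Summit.AnomalousDissipation.AnomalousDissipation.Theorems.SolenoidalFractalHomogenisation.LagrangianStep.CellClauseMod

/-- **(V_E)ᵀᴷ — EulerPiece with the carrier template AND the cascade (Bloch) binder of memo L24 (R-L24-1)**: `SlowVectorClauseEulerPieceT` VERBATIM with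
ONE per-level binder inserted after the Bloch threshold `⌈K/ν⌉ ≤ N(m+1)`: `K·(N(m+1)/N m)^{1/4} ≤ (N(m+1)/N m)·cellVisc(m+1)` (the §9z template's
viscosity floor with the clause's `K`).  [cite: ArmstrongVicol2025, §4.1 (PDF p. 34) and §5.1 (the distortion of the flows of b_{m−1})] -/
def SlowVectorClauseEulerPieceTK {k : ℕ} (W : LatticeWord k) (M : ℝ) (hM : 0 < M) (c : ℝ)
    (Φ : ℝ → Torus.Visc4 (Fin 3) → Torus.Visc4 (Fin 3)) (lo hi Λ β σ C ν₀ K θ₁ ϱ₁ : ℝ) : Prop :=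
  ∀ E : LagrangianLatticeCarrier k, E.design = W.stretch M hM → E.gain = c → E.LPermissible → E.Regular →
  (∀ m, E.N m ^ 2 ≤ E.N (m + 1)) → (∀ m, E.θ (m + 1) * ((E.N (m + 1) : ℝ) / E.N m) ^ (1 / 16 : ℝ) ≤ θ₁) →
  ∀ m : ℕ, E.cellVisc (m + 1) < ν₀ → (⌈K / E.cellVisc (m + 1)⌉₊ : ℝ) ≤ E.N (m + 1) →
  K * ((E.N (m + 1) : ℝ) / E.N m) ^ (1 / 4 : ℝ) ≤ ((E.N (m + 1) : ℝ) / E.N m) * E.cellVisc (m + 1) →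
  (E.N m : ℝ) ≤ ϱ₁ * E.N (m + 1) →
  ∀ S : Torus.Visc4 (Fin 3), Torus.OddSmall S β → (∃ lam ∈ Set.Icc (1:ℝ) Λ, Torus.NearIso S (lo / lam) (hi * lam)) →
    Torus.OddSmall (Φ (E.cellVisc (m + 1)) S) β → (∃ lam ∈ Set.Icc (1:ℝ) Λ, Torus.NearIso (Φ (E.cellVisc (m + 1)) S) (lo / lam) (hi * lam)) →
  ∀ Um Um1 : ℝ → ℝ → (V2 →L[ℝ] V2),
    Torus.IsPropagator 1 (E.partialSum m) (E.kbar m • renormStep (Φ (E.cellVisc (m + 1))) (E.gain / E.cellVisc (m + 1) ^ 2) S) Um →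
    Torus.IsPropagator 1 (E.partialSum (m + 1)) (E.kbar (m + 1) • S) Um1 →
  ∀ (j : ℕ) (s t : ℝ), s = (j : ℝ) * E.refresh (m + 1) → s < t → t ≤ s + E.refresh (m + 1) → t ≤ 1 →
  ∀ x y : V2,
    |⟪Um1 s t x - Um s t x, y⟫_ℝ|
      ≤ (C * (C * (E.cellVisc (m + 1) ^ σ + ((⌈K / E.cellVisc (m + 1)⌉₊ : ℝ) / E.N (m + 1)) ^ σ + E.θ (m + 1) ^ σ
            + ((E.N m : ℝ) / E.N (m + 1)) ^ σ)
          + (min 1 ((M * W.period / E.cellVisc (m + 1)) / (E.a (m + 1) * (t - s)))) ^ σ))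
        * Real.sqrt (lossFwd (Um s t) x) * Real.sqrt (lossAdj (Um s t) y)

/-- The K-clause is WEAKER than the clause of record (ignore the new binder). -/
theorem slowVectorClauseEulerPieceTK_of_pieceT {k : ℕ} {W : LatticeWord k} {M : ℝ} {hM : 0 < M} {c : ℝ}
    {Φ : ℝ → Torus.Visc4 (Fin 3) → Torus.Visc4 (Fin 3)} {lo hi Λ β σ C ν₀ K θ₁ ϱ₁ : ℝ}
    (h : SlowVectorClauseEulerPieceT W M hM c Φ lo hi Λ β σ C ν₀ K θ₁ ϱ₁) : SlowVectorClauseEulerPieceTK W M hM c Φ lo hi Λ β σ C ν₀ K θ₁ ϱ₁ :=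
  fun E hdes hgain hLP hReg hN2 hT4 m hν hKn _ hN => h E hdes hgain hLP hReg hN2 hT4 m hν hKn hN

/-- **`Vmod_E_textHTXK X e`** — `Vmod_E_textHTX X e` VERBATIM except that it concludes the K-clause `SlowVectorClauseEulerPieceTK` (v29 registered shape:
`stub_Vmod_EHTthgw : Vmod_E_textHTXK Xθgw (fun σ => min (σ/2) (1/2))`, RULINGS D28-19 (3) / D28-22 (1)). -/
def Vmod_E_textHTXK (X : ∀ {k : ℕ}, LatticeWord k → (M : ℝ) → 0 < M → ℝ → (ℝ → Torus.Visc4 (Fin 3) → Torus.Visc4 (Fin 3)) → ℝ → ℝ → ℝ → ℝ → ℝ → ℝ → ℝ → ℝ → Prop) (e : ℝ → ℝ) : Prop :=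
  ∀ k (W : LatticeWord k) (M : ℝ) (hM : 0 < M) (c : ℝ), 0 < c →
  ∀ (Φ : ℝ → Torus.Visc4 (Fin 3) → Torus.Visc4 (Fin 3)) (lo hi Λ β σ C ν₀ K : ℝ),
    0 < lo → lo ≤ 1 → 1 ≤ hi → 1 < Λ → 0 ≤ β → 0 < σ → 0 ≤ C → 0 < ν₀ → ν₀ ≤ 1 → 0 < K →
    SlowVectorClauseF W M hM c Φ lo hi Λ β σ C ν₀ K →
    X W M hM c Φ lo hi Λ β σ C ν₀ K →
    (∀ Kb : ℝ, 1 ≤ Kb → ∃ CK : ℝ, 1 ≤ CK ∧ ∃ cK > (0:ℝ), ∃ νh > (0:ℝ), HighLabelDecayW W M hM lo hi Λ β νh Kb CK cK) →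
    ∃ θ₁ > (0:ℝ), ∃ ϱ₁ > (0:ℝ), ∃ Cm : ℝ, C ≤ Cm ∧ SlowVectorClauseEulerPieceTK W M hM c Φ lo hi Λ β (e σ) Cm ν₀ K θ₁ ϱ₁

/-- **The superseded-by-WEAKER certificate** of the v29 move on the Vmod side: the text of record implies the K-text. -/
theorem vmod_E_textHTXK_of_HTX
    {X : ∀ {k : ℕ}, LatticeWord k → (M : ℝ) → 0 < M → ℝ → (ℝ → Torus.Visc4 (Fin 3) → Torus.Visc4 (Fin 3)) → ℝ → ℝ → ℝ → ℝ → ℝ → ℝ → ℝ → ℝ → Prop}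
    {e : ℝ → ℝ} (h : Vmod_E_textHTX X e) : Vmod_E_textHTXK X e := by
  intro k W M hM c hc Φ lo hi Λ β σ C ν₀ K hlo hlo1 hhi hΛ hβ hσ hC hν₀ hν₀1 hK hV hX hH
  obtain ⟨θ₁, hθ₁, ϱ₁, hϱ₁, Cm, hCm, hP⟩ := h k W M hM c hc Φ lo hi Λ β σ C ν₀ K hlo hlo1 hhi hΛ hβ hσ hC hν₀ hν₀1 hK hV hX hH
  exact ⟨θ₁, hθ₁, ϱ₁, hϱ₁, Cm, hCm, slowVectorClauseEulerPieceTK_of_pieceT hP⟩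

/-- **Antitone in the extra binder**: a STRONGER binder `X'` (`X' → X` pointwise) gives a weaker text, so `Vmod_E_textHTXK X e → Vmod_E_textHTXK X' e`
(used by the v29 certificate with `X := Xθg`, `X' := Xθgw`). -/
theorem vmod_E_textHTXK_anti
    {X X' : ∀ {k : ℕ}, LatticeWord k → (M : ℝ) → 0 < M → ℝ → (ℝ → Torus.Visc4 (Fin 3) → Torus.Visc4 (Fin 3)) → ℝ → ℝ → ℝ → ℝ → ℝ → ℝ → ℝ → ℝ → Prop}
    (hXX' : ∀ {k : ℕ} (W : LatticeWord k) (M : ℝ) (hM : 0 < M) (c : ℝ) (Φ : ℝ → Torus.Visc4 (Fin 3) → Torus.Visc4 (Fin 3))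
      (lo hi Λ β σ C ν₀ K : ℝ), X' W M hM c Φ lo hi Λ β σ C ν₀ K → X W M hM c Φ lo hi Λ β σ C ν₀ K)
    {e : ℝ → ℝ} (h : Vmod_E_textHTXK X e) : Vmod_E_textHTXK X' e :=
  fun k W M hM c hc Φ lo hi Λ β σ C ν₀ K hlo hlo1 hhi hΛ hβ hσ hC hν₀ hν₀1 hK hV hX' hH =>
    h k W M hM c hc Φ lo hi Λ β σ C ν₀ K hlo hlo1 hhi hΛ hβ hσ hC hν₀ hν₀1 hK hV (hXX' W M hM c Φ lo hi Λ β σ C ν₀ K hX') hH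

end Summit.AnomalousDissipation.AnomalousDissipation.Theorems.SolenoidalFractalHomogenisation.LagrangianStep.Z7Glue

end
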